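import Literature.AnabelianGeometry.EtaleTheta.RootsOfUnityGalois
import Mathlib.RingTheory.Polynomial.Eisenstein.IsIntegral
import Mathlib.RingTheory.Polynomial.GaussLemma
import Mathlib.RingTheory.Polynomial.Cyclotomic.Roots
import Mathlib.RingTheory.Polynomial.Cyclotomic.Eval
import Mathlib.NumberTheory.Padics.PadicIntegers
import Mathlib.FieldTheory.Galois.Infinite
import HarnessLib

/-!
# `ζ_p ∉ ℚ_p` for an odd prime `p`: the mod-`p` cyclotomic character of `G_{ℚ_p}` is non-trivial (classical)

Companion of `RootsOfUnityGaloisNontrivial.lean` (abc-iut-w5-d125: the uniform `p²`-level statement, incl.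
`p = 2`). For ODD `p` the obstruction already appears at level `p`: `Φ_p(X+1)` is Eisenstein at `p`
(Mathlib's `cyclotomic_comp_X_add_one_isEisensteinAt`), so `Φ_p` is irreducible of degree `p − 1 ≥ 2` over
`ℚ_p` and `G_{ℚ_p}` moves a primitive `p`-th root of unity — `ℚ_p(ζ_p)/ℚ_p` is totally ramified of degree
`p − 1` [cite: SerreLocalFields1979, IV §4 Prop 17]. Consequence for the cell's NV census
(`SettingModelCyclotomeModEmpty.lean`): at the root model `CyclotomeMod l N = ∅` for every `N` with `p ∣ N`
when `p` is odd. Proof-only; no definition, no Prop fact; nothing of [EtTh] is asserted.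
-/

noncomputable section

namespace Literature.AnabelianGeometry.EtaleTheta

open Polynomial Literature.AnabelianGeometry.SemiGraphs

variable (p : ℕ) [hp : Fact p.Prime]

omit hp in
/-- `Φ_p(X + 1) ∈ ℤ[X]` is monic. [folklore] -/
private theorem monic_cyclotomic_prime_comp_X_add_one : ((cyclotomic p ℤ).comp (X + 1)).Monic := by
  rw [show (X + 1 : ℤ[X]) = X + C 1 by simp]
  refine (cyclotomic.monic _ ℤ).comp (monic_X_add_C 1) fun h => ?_
  rw [natDegree_X_add_C] at h
  exact zero_ne_one h.symm

/-- The degree of `Φ_p(X + 1)` is `p - 1`. [folklore] -/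
private theorem natDegree_cyclotomic_prime_comp_X_add_one :
    ((cyclotomic p ℤ).comp (X + 1)).natDegree = p - 1 := by
  rw [natDegree_comp, show (X + 1 : ℤ[X]) = X + C 1 by simp, natDegree_X_add_C, mul_one,
    natDegree_cyclotomic, Nat.totient_prime hp.out]

/-- **`Φ_p(X+1)` is Eisenstein at the maximal ideal of `ℤ_p`** (`Φ_p(1) = p ∉ (p²)`).
[cite: SerreLocalFields1979, IV §4 Prop 17] -/
theorem cyclotomic_prime_comp_X_add_one_isEisensteinAt_padicInt :
    (((cyclotomic p ℤ).comp (X + 1)).map (Int.castRingHom ℤ_[p])).IsEisensteinAt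
      (IsLocalRing.maximalIdeal ℤ_[p]) := by
  have hE : ((cyclotomic p ℤ).comp (X + 1)).IsEisensteinAt (Submodule.span ℤ {(p : ℤ)}) :=
    cyclotomic_comp_X_add_one_isEisensteinAt p
  have hmonic := (monic_cyclotomic_prime_comp_X_add_one p).map (Int.castRingHom ℤ_[p])
  refine hmonic.isEisensteinAt_of_mem_of_notMem (IsLocalRing.maximalIdeal.isMaximal ℤ_[p]).ne_top ?_ ?_
  · intro n hn
    have hw := (hE.isWeaklyEisensteinAt.map (Int.castRingHom ℤ_[p])).mem hn
    have hmap : Ideal.map (Int.castRingHom ℤ_[p]) (Submodule.span ℤ {(p : ℤ)}) =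
        Ideal.span {(p : ℤ_[p])} := by
      rw [Ideal.submodule_span_eq, Ideal.map_span, Set.image_singleton, map_natCast]
    rw [PadicInt.maximalIdeal_eq_span_p, ← hmap]
    exact hw
  · rw [coeff_map, coeff_zero_eq_eval_zero, eval_comp, eval_add, eval_X, eval_one, zero_add,
      eval_one_cyclotomic_prime, map_natCast, PadicInt.maximalIdeal_eq_span_p,
      Ideal.span_singleton_pow, Ideal.mem_span_singleton]
    rintro ⟨c, hc⟩
    have hp0 : (p : ℤ_[p]) ≠ 0 := by exact_mod_cast hp.out.ne_zero
    have h1 : (p : ℤ_[p]) * 1 = (p : ℤ_[p]) * (p * c) := by rw [mul_one, ← mul_assoc, ← sq]; exact hc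
    have h2 : (1 : ℤ_[p]) = p * c := mul_left_cancel₀ hp0 h1
    exact (PadicInt.irreducible_p (p := p)).not_isUnit (isUnit_iff_exists_inv.2 ⟨c, h2.symm⟩)

/-- The base change to `ℚ_p` of `Φ_p(X+1) ∈ ℤ_p[X]` is `Φ_p(X+1) ∈ ℚ_p[X]`. [folklore] -/
private theorem map_cyclotomic_prime_comp_eq :
    (((cyclotomic p ℤ).comp (X + 1)).map (Int.castRingHom ℤ_[p])).map (algebraMap ℤ_[p] ℚ_[p]) =
      (cyclotomic p ℚ_[p]).comp (X + 1) := by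
  rw [Polynomial.map_map, map_comp, Polynomial.map_add, map_X, Polynomial.map_one]
  congr 1
  have : (algebraMap ℤ_[p] ℚ_[p]).comp (Int.castRingHom ℤ_[p]) = Int.castRingHom ℚ_[p] :=
    RingHom.ext_int _ _
  rw [this, map_cyclotomic_int]

/-- **`Φ_p(X+1)` is irreducible over `ℚ_p`** (Eisenstein over `ℤ_p` + Gauss; every prime `p`).
[cite: SerreLocalFields1979, IV §4 Prop 17] -/
theorem irreducible_cyclotomic_prime_comp_padic :
    Irreducible ((cyclotomic p ℚ_[p]).comp (X + 1)) := by
  have hirr : Irreducible (((cyclotomic p ℤ).comp (X + 1)).map (Int.castRingHom ℤ_[p])) := by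
    have hmonic := (monic_cyclotomic_prime_comp_X_add_one p).map (Int.castRingHom ℤ_[p])
    refine (cyclotomic_prime_comp_X_add_one_isEisensteinAt_padicInt p).irreducible
      (IsLocalRing.maximalIdeal.isMaximal ℤ_[p]).isPrime hmonic.isPrimitive ?_
    rw [(monic_cyclotomic_prime_comp_X_add_one p).natDegree_map, natDegree_cyclotomic_prime_comp_X_add_one]
    have := hp.out.two_le
    omega
  rw [← map_cyclotomic_prime_comp_eq]
  exact (((monic_cyclotomic_prime_comp_X_add_one p).map
    (Int.castRingHom ℤ_[p])).irreducible_iff_irreducible_map_fraction_map (K := ℚ_[p])).1 hirr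

/-- **For odd `p`, `Φ_p` has no root in `ℚ_p`** (`[ℚ_p(ζ_p) : ℚ_p] = p − 1 ≥ 2`).
[cite: SerreLocalFields1979, IV §4 Prop 17] -/
theorem not_isRoot_cyclotomic_prime_padic (hp2 : p ≠ 2) (x : ℚ_[p]) :
    ¬ IsRoot (cyclotomic p ℚ_[p]) x := by
  intro hx
  have hroot : IsRoot ((cyclotomic p ℚ_[p]).comp (X + 1)) (x - 1) := by
    rw [IsRoot, eval_comp, eval_add, eval_X, eval_one, sub_add_cancel]
    exact hx
  have h1 := degree_eq_one_of_irreducible_of_root (irreducible_cyclotomic_prime_comp_padic p) hroot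
  have hdeg : ((cyclotomic p ℚ_[p]).comp (X + 1)).natDegree = p - 1 := by
    rw [natDegree_comp, show (X + 1 : ℚ_[p][X]) = X + C 1 by simp, natDegree_X_add_C, mul_one,
      natDegree_cyclotomic, Nat.totient_prime hp.out]
  have h2 : ((cyclotomic p ℚ_[p]).comp (X + 1)).natDegree = 1 := natDegree_eq_of_degree_eq_some h1
  have h3 := hp.out.two_le
  omega

/-- For odd `p`, a primitive `p`-th root of unity of `ℚ̄_p` is not in `ℚ_p`.
[cite: SerreLocalFields1979, IV §4 Prop 17] -/
theorem not_mem_range_algebraMap_of_isPrimitiveRoot_prime (hp2 : p ≠ 2) {ζ : PadicAlgCl p}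
    (hζ : IsPrimitiveRoot ζ p) : ζ ∉ Set.range (algebraMap ℚ_[p] (PadicAlgCl p)) := by
  rintro ⟨x, rfl⟩
  have hx : IsPrimitiveRoot x p :=
    hζ.of_map_of_injective (f := algebraMap ℚ_[p] (PadicAlgCl p)) (algebraMap ℚ_[p] (PadicAlgCl p)).injective
  haveI : NeZero ((p : ℕ) : ℚ_[p]) := ⟨by exact_mod_cast hp.out.ne_zero⟩
  exact not_isRoot_cyclotomic_prime_padic p hp2 x ((isRoot_cyclotomic_iff).2 hx)

/-- **For odd `p`, some `σ ∈ G_{ℚ_p}` moves a primitive `p`-th root of unity.**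
[cite: SerreLocalFields1979, IV §4 Prop 17] -/
theorem exists_isPrimitiveRoot_prime_and_apply_ne (hp2 : p ≠ 2) :
    ∃ (ζ : PadicAlgCl p) (σ : GQp p), IsPrimitiveRoot ζ p ∧ σ ζ ≠ ζ := by
  haveI : NeZero ((p : ℕ) : PadicAlgCl p) := ⟨by exact_mod_cast hp.out.ne_zero⟩
  obtain ⟨ζ, hζ⟩ := HasEnoughRootsOfUnity.prim (M := PadicAlgCl p) (n := p)
  refine ⟨ζ, ?_⟩
  by_contra hall
  push Not at hall
  haveI : IsGalois ℚ_[p] (PadicAlgCl p) := {}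
  have hmem : ζ ∈ IntermediateField.fixedField (⊤ : Subgroup (GQp p)) := by
    rw [IntermediateField.mem_fixedField_iff]
    intro σ _
    by_contra hne
    exact hne (hall σ hζ)
  rw [← IntermediateField.fixingSubgroup_bot, InfiniteGalois.fixedField_fixingSubgroup,
    IntermediateField.mem_bot] at hmem
  exact not_mem_range_algebraMap_of_isPrimitiveRoot_prime p hp2 hζ hmem

/-- **For odd `p` and `p ∣ N`, the mod-`N` cyclotomic character of `G_{ℚ_p}` is non-trivial**: some
`σ ∈ G_{ℚ_p}` moves some `ζ ∈ μ_N(ℚ̄_p)`. [cite: SerreLocalFields1979, IV §4 Prop 17] -/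
theorem exists_galMuN_apply_ne_of_prime_dvd (hp2 : p ≠ 2) (N : ℕ+) (hN : p ∣ (N : ℕ)) :
    ∃ (σ : GQp p) (ζ : MuN p N), galMuN p N σ ζ ≠ ζ := by
  obtain ⟨ζ, σ, hζ, hσ⟩ := exists_isPrimitiveRoot_prime_and_apply_ne p hp2
  have hunit : IsUnit ζ := hζ.isUnit hp.out.ne_zero
  have hmem : hunit.unit ∈ rootsOfUnity N (PadicAlgCl p) := by
    rw [mem_rootsOfUnity, Units.ext_iff, Units.val_pow_eq_pow_val, IsUnit.unit_spec, Units.val_one]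
    obtain ⟨k, hk⟩ := hN
    rw [hk, pow_mul, hζ.pow_eq_one, one_pow]
  refine ⟨σ, ⟨hunit.unit, hmem⟩, fun h => hσ ?_⟩
  have h' := congrArg (fun u : MuN p N => ((u : (PadicAlgCl p)ˣ) : PadicAlgCl p)) h
  simpa only [galMuN_apply_coe, IsUnit.unit_spec] using h'

/-- Equivalently `galMuN p N ≠ 1` for odd `p ∣ N`. [cite: SerreLocalFields1979, IV §4 Prop 17] -/
theorem galMuN_ne_one_of_prime_dvd (hp2 : p ≠ 2) (N : ℕ+) (hN : p ∣ (N : ℕ)) : galMuN p N ≠ 1 := by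
  intro h
  obtain ⟨σ, ζ, hne⟩ := exists_galMuN_apply_ne_of_prime_dvd p hp2 N hN
  exact hne (by rw [h]; rfl)

end Literature.AnabelianGeometry.EtaleTheta

end
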